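import Summits.QuantumFields.YangMills.Theorems.LuscherReductionTwistedTraceScalingBOStiffSliceModel
import Summits.QuantumFields.YangMills.Theorems.LuscherReductionTwistedTraceScalingBOStiffFlatCoords
import Summits.QuantumFields.YangMills.Theorems.LuscherReductionTwistedTraceScalingBOStiffPiDensityCentral
import Summits.QuantumFields.YangMills.Theorems.LuscherReductionTwistedTraceScalingBOStiffRing
import HarnessLib

/-!
# (B-ST) (W1-10 (A4), part 1) `…BOStiffQuasimodeModel`: the Hessian-form slice integral of (A) pulled back along the lead's flat coordinates — dictionary and change of variables
# (lane A of S-BASE, crux `TwistedTraceScaling` stmt-QuantumFields-20203, C4-CORE, the (B-ST) pen; (A) split (A4))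

Objects: `V_β = (StiffIdx β → ℝ) × gaugeModes L`, `flatMap β : V_β →ₗ (Edge → ℝ³)` (✓`…BOStiffFlatCoords`: injective, range = balancedSet, dictionary).  This file:
* §1 `flatMap_preimage_cS` — for `r_f(β) ≤ 1/2`: `flatMap β ⁻¹' cS β = {p | Σ (γᵢpᵢ)² + ‖p.2‖² ≤ r_f²}` (the weighted profile ball, weights `wᵢ = γᵢ² = flatScale²`);
* §2 `hessianIntegrand_flatMap` — for `x = flatMap p₀`, `y = flatMap p`: the Hessian-form slice integrand
  `e^{−⟨x̂,(β/2)Hx̂⟩}·e^{−⟨ŷ,(β/2)Hŷ⟩}·e^{−β‖(x̂−ŷ)−P_Γ(x̂−ŷ)‖²}·e^{−‖P_Γŷ‖²/β^{-2}}·e^{−q_β(ŷ)}` EQUALS the flat integrand `F_{p₀.1}(p)` of ✓`…BOStiffSliceModel` with `ã = flatA`, `b̃ = flatB`, `c = π`, `s = β⁻¹`;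
* §3 ★ `setIntegral_cS_balLebesgue_eq_flat` — `∫_{cS} f d(balLebesgue) = κ·∫_{flatMap⁻¹ cS} f∘flatMap d(vol)` (✓`balLebesgue_eq_smul_map`, `setIntegral_map`).
Part 2 (`…BOStiffQuasimodeSlice`) turns these + ✓`sliceModel_upper/lower` + ✓`setIntegral_cS_sharp` + ✓(A1) into the two-sided slice bounds `hJup/hJlo` of ✓`quasimode_of_twins`.
HONEST FRAMING: bookkeeping for a stub of a child of the CONDITIONAL route R2b1; (Q±) OPEN; (B-ST), C4-CORE OPEN; not infinite volume, not a gap, not Clay.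
-/

set_option autoImplicit false

noncomputable section

open MeasureTheory Filter Topology Real
open scoped BigOperators RealInnerProductSpace NNReal ENNReal
open Literature.MathematicalPhysics.QuantumFieldTheory
open Literature.MathematicalPhysics.QuantumLattice

namespace Summit.QuantumFields.YangMills.Theorems.FemtoTransferGap.TwoLattice.ConstTube

open Summit.QuantumFields.YangMills.Theorems.FemtoTransferGap
open Summit.QuantumFields.YangMills.Theorems.FemtoTransferGap.TwoLattice
open Summit.QuantumFields.YangMills.Theorems.FemtoTransferGap.TwoLattice.Stiff
open Summit.QuantumFields.YangMills.Theorems.FemtoTransferGap.TwoLattice.GnChart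

variable {L : ℕ} [NeZero L]

/-! ## §1 The profile ball in flat coordinates -/

/-- A balanced vector of Euclidean norm `≤ 1/2` lies in the cap. [folklore] -/
theorem mem_capBalancedSet_of_norm_le {v : Edge 3 L → Fin 3 → ℝ} (hv : v ∈ balancedSet L) (hn : ‖linkEmbed L v‖ ≤ 1 / 2) : v ∈ capBalancedSet L := by
  refine ⟨hv, fun e => ?_⟩
  have h1 : ∑ a, v e a ^ 2 ≤ ∑ e' : Edge 3 L, ∑ a, v e' a ^ 2 :=
    Finset.single_le_sum (f := fun e' => ∑ a, v e' a ^ 2) (fun e' _ => Finset.sum_nonneg fun a _ => sq_nonneg _) (Finset.mem_univ e)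
  rw [← norm_linkEmbed_sq] at h1
  nlinarith [norm_nonneg (linkEmbed L v)]

/-- `flatMap β ⁻¹' cS β` is the weighted profile ball `{Σ(γᵢpᵢ)² + ‖p.2‖² ≤ r_f²}` whenever `r_f(β) ≤ 1/2`. [folklore] -/
theorem flatMap_preimage_cS {β : ℝ} (hr : min (1 / 40) (powScale (1 / 2) β * btLog β) ≤ 1 / 2) :
    flatMap L β ⁻¹' cS L β = {p : (StiffIdx L β → ℝ) × gaugeModes L |
      (∑ i, (flatScale L β i * p.1 i) ^ 2) + ‖(p.2 : LinkSpace L)‖ ^ 2 ≤ (min (1 / 40) (powScale (1 / 2) β * btLog β)) ^ 2} := by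
  ext p
  rw [Set.mem_preimage, mem_cS_iff, Set.mem_setOf_eq, linkEmbed_flatMap, ← norm_flatVec_sq]
  have hr0 : 0 ≤ min (1 / 40) (powScale (1 / 2) β * btLog β) := le_min (by norm_num) (mul_nonneg (powScale_pos _ _).le (zero_le_one.trans (one_le_btLog β)))
  constructor
  · rintro ⟨-, hn⟩; exact pow_le_pow_left₀ (norm_nonneg _) hn 2
  · intro h
    have hn : ‖flatVec L β p‖ ≤ min (1 / 40) (powScale (1 / 2) β * btLog β) := (pow_le_pow_iff_left₀ (norm_nonneg _) hr0 two_ne_zero).mp h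
    refine ⟨mem_capBalancedSet_of_norm_le (flatMap_mem_balancedSet β p) ?_, hn⟩
    rw [linkEmbed_flatMap]; exact hn.trans hr

/-! ## §2 The Hessian-form integrand in flat coordinates -/

/-- ★ **Dictionary for the slice integrand**: for `0 < β`, `p₀ p : V_β`, with `x̂ = flatVec p₀`, `ŷ = flatVec p`:
`e^{−⟨x̂,(β/2)Hx̂⟩}·e^{−⟨ŷ,(β/2)Hŷ⟩}·e^{−β‖(x̂−ŷ) − P_Γ(x̂−ŷ)‖²}·e^{−‖P_Γŷ‖²/(β^{-1})²}·e^{−q_β(ŷ)} = F_{p₀.1}(p)` (the flat integrand with `ã = flatA`, `b̃ = flatB`, `c = π`, `s = β⁻¹`-scale). [folklore] -/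
theorem hessianIntegrand_flatVec {β : ℝ} (hβ : 0 < β) (s : ℝ) (p₀ p : (StiffIdx L β → ℝ) × gaugeModes L) :
    Real.exp (-⟪flatVec L β p₀, ((β / 2) • stiffHessian L) (flatVec L β p₀)⟫) * Real.exp (-⟪flatVec L β p, ((β / 2) • stiffHessian L) (flatVec L β p)⟫) *
        Real.exp (-(β * ‖(flatVec L β p₀ - flatVec L β p) - (gaugeModes L).starProjection (flatVec L β p₀ - flatVec L β p)‖ ^ 2)) *
        Real.exp (-(‖(gaugeModes L).starProjection (flatVec L β p)‖ ^ 2 / s ^ 2)) * Real.exp (-(stiffGaussExp L (β / 2) β (flatVec L β p))) =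
      (∏ i, Real.exp (-(flatA L β i * p₀.1 i ^ 2)) * Real.exp (-(flatB L β i * (p₀.1 i - p.1 i) ^ 2)) * Real.exp (-(flatA L β i * p.1 i ^ 2)) *
          Real.exp (-(Real.pi * p.1 i ^ 2))) * Real.exp (-(‖(p.2 : LinkSpace L)‖ ^ 2 / s ^ 2)) := by
  -- the four dictionary entries
  have h1 : ⟪flatVec L β p₀, ((β / 2) • stiffHessian L) (flatVec L β p₀)⟫ = ∑ i, flatA L β i * p₀.1 i ^ 2 := inner_hessian_flatVec β p₀
  have h2 : ⟪flatVec L β p, ((β / 2) • stiffHessian L) (flatVec L β p)⟫ = ∑ i, flatA L β i * p.1 i ^ 2 := inner_hessian_flatVec β p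
  have h3 : β * ‖(flatVec L β p₀ - flatVec L β p) - (gaugeModes L).starProjection (flatVec L β p₀ - flatVec L β p)‖ ^ 2 = ∑ i, flatB L β i * (p₀.1 i - p.1 i) ^ 2 := by
    rw [← map_sub, flatVec_sub_starProjection, norm_stiffPart_sq, Finset.mul_sum]
    refine Finset.sum_congr rfl fun i _ => ?_
    simp only [Prod.fst_sub, Pi.sub_apply, flatB]; ring
  have h4 : ‖(gaugeModes L).starProjection (flatVec L β p)‖ = ‖(p.2 : LinkSpace L)‖ := by rw [starProjection_gaugeModes_flatVec]
  have h5 : stiffGaussExp L (β / 2) β (flatVec L β p) = ∑ i, Real.pi * p.1 i ^ 2 := by rw [stiffGaussExp_flatVec hβ, Finset.mul_sum]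
  rw [h1, h2, h3, h4, h5]
  -- regroup the exponentials into the product
  rw [Finset.prod_mul_distrib, Finset.prod_mul_distrib, Finset.prod_mul_distrib, ← Real.exp_sum, ← Real.exp_sum, ← Real.exp_sum, ← Real.exp_sum,
    Finset.sum_neg_distrib, Finset.sum_neg_distrib, Finset.sum_neg_distrib, Finset.sum_neg_distrib]
  ring

/-! ## §3 Change of variables `balLebesgue → vol on V_β` -/

/-- ★ **Pullback of `cS`-integrals along `flatMap`**: for `0 < β` there is `κ > 0` (the Haar constant of ✓`balLebesgue_eq_smul_map`, β-dependent through `flatMap β`) with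
`∫_{cS} f d(balLebesgue) = κ·∫_{flatMap⁻¹ cS} f∘flatMap d(vol)` for every measurable `f`. [folklore] -/
theorem setIntegral_cS_balLebesgue_eq_flat {β : ℝ} (hβ : 0 < β) :
    ∃ κ : ℝ, 0 < κ ∧ ∀ (f : (Edge 3 L → Fin 3 → ℝ) → ℝ), Measurable f → ∀ A : Set (Edge 3 L → Fin 3 → ℝ), MeasurableSet A →
      ∫ x in A, f x ∂balLebesgue L = κ * ∫ p in flatMap L β ⁻¹' A, f (flatMap L β p) ∂(volume : Measure ((StiffIdx L β → ℝ) × gaugeModes L)) := by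
  haveI h1 : (volume : Measure (StiffIdx L β → ℝ)).IsAddHaarMeasure := inferInstance
  haveI h2 : (volume : Measure (gaugeModes L)).IsAddHaarMeasure := inferInstance
  haveI : (volume : Measure ((StiffIdx L β → ℝ) × gaugeModes L)).IsAddHaarMeasure :=
    Measure.prod.instIsAddHaarMeasure (volume : Measure (StiffIdx L β → ℝ)) (volume : Measure (gaugeModes L))
  obtain ⟨κ, hκ, hν⟩ := balLebesgue_eq_smul_map L (volume : Measure ((StiffIdx L β → ℝ) × gaugeModes L)) (T := flatMap L β) (flatMap_injective hβ) (range_flatMap hβ)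
  refine ⟨κ, by exact_mod_cast hκ, fun f hf A hA => ?_⟩
  have hTm : Measurable (flatMap L β : ((StiffIdx L β → ℝ) × gaugeModes L) → (Edge 3 L → Fin 3 → ℝ)) :=
    (LinearMap.continuous_of_finiteDimensional _).measurable
  rw [hν, Measure.restrict_smul, integral_smul_measure, setIntegral_map hA hf.aestronglyMeasurable hTm.aemeasurable, ENNReal.coe_toReal, smul_eq_mul]

end Summit.QuantumFields.YangMills.Theorems.FemtoTransferGap.TwoLattice.ConstTube

end
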